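import Summits.AtomisticToContinuum.HydrodynamicLimit.Theorems.TwoClocksTransferActivityTailsTaggedSumMeasurable
import Summits.AtomisticToContinuum.HydrodynamicLimit.Theorems.TransferActivityTails.Negative.EquilibriumReduction
import Literature.Analysis.FluidPDE.HardSphereCollisionRecordMeasurable
import HarnessLib

/-!
# Measurability of the hot-supply window sum (stub `stub_hotSupplyMeasurable`)

Crux `Summit.AtomisticToContinuum.HydrodynamicLimit.Theses.OneFlightGossipEngine.EnergyActivityTails`
(stmt-AtomisticToContinuum-17703), line `Sketch` (card `coboundary-hot-cold-split`), registered stub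
`stub_hotSupplyMeasurable : HotSupplyMeasurable` (the defs `hotSupplyOf`, `HotSupplyMeasurable` re-declared verbatim
from the line skeleton; Theorems files cannot import the crux workfile).

For `0 < σ < 1/2`, every cap `M`, particle `i` and window `(a, b]`, the hot-supply window sum
`z ↦ Σ_{collisions in (a, b]} hotSupplyOf M N i`, extended by `0` off the good set of the hard-sphere flow `Φ`, is
measurable in the datum.  This is the instance `F := hotSupplyOf M N i` of the tree tool
`TransferActivityTailsTaggedSumMeasurable.measurable_indicator_collisionSum_Ioc` (collision sums over `(a, b]` of
MEASURABLE, TIME-STAMP-BLIND functionals of the record are measurable after extension by `0`): the functional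
`c ↦ 𝟙{c.fst = i ∧ M < |⟪v_snd⁻, ω⟫|} · max ((‖v_fst⁺‖² − ‖v_fst⁻‖²)/2) 0` is measurable for the product σ-algebra of
records (`HardSphereCollisionRecord.measurable_indices/preVel/postVel/impactVec`, `Measurable.ite/inner/abs/max`), and it
never reads the time stamp of `HardSphereCollisionRecord.ofConfig` (`rfl`).  Adapted from
`TransferActivityTailsTaggedSumMeasurable.stub_collisionSumMeasurable` / `ClampedTransferCoin.measurable_ite_fst_impulse`.
-/

noncomputable section

open MeasureTheory Set
open scoped InnerProductSpace

namespace Summit.AtomisticToContinuum.HydrodynamicLimit.Theorems.EnergyActivityTailsHotSupplyMeasurable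

open Literature.MathematicalPhysics.KineticTheory Literature.Analysis.FluidPDE
open Summit.AtomisticToContinuum.HydrodynamicLimit.Theorems.TransferActivityTailsNegative (Flow Rec)

/-! ## The statement (verbatim from the line skeleton) -/

/-- **Hot supply at cap `M`**: the energy RECEIVED by `i` (positive part of its gain) in a collision whose partner arrives
with normal speed `|⟪v_snd⁻, ω⟫| > M`; zero on every collision with a cold-normal partner. -/
def hotSupplyOf (M : ℝ) (N : ℕ) (i : Fin (N + 1)) (c : Rec N) : ℝ :=
  if c.fst = i ∧ M < |⟪c.preVel.2, c.impactVec⟫_ℝ| then max ((‖c.postVel.1‖ ^ 2 - ‖c.preVel.1‖ ^ 2) / 2) 0 else 0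

/-- **MEASURABILITY OF THE HOT SUPPLY** (window sum over any `(a, b]`, extended by `0` off the good set; `0 < σ < 1/2`). -/
def HotSupplyMeasurable : Prop :=
  ∀ (σ : ℝ), 0 < σ → σ < 1 / 2 → ∀ (M : ℝ) (N : ℕ) (Φ : Flow σ N) (i : Fin (N + 1)) (a b : ℝ),
    Measurable (Φ.good.indicator fun z => Φ.collisionSum (Set.Ioc a b) (hotSupplyOf M N i) z)

/-! ## The proof -/

/-- The hot supply `hotSupplyOf M N i` is a measurable functional of the record: an `if` over the measurable event
`{c.fst = i} ∩ {M < |⟪v_snd⁻, ω⟫|}` (discrete labels; measurable inner product of measurable fields) between the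
measurable `max ((‖v_fst⁺‖² − ‖v_fst⁻‖²)/2) 0` and `0`. -/
theorem measurable_hotSupplyOf (M : ℝ) (N : ℕ) (i : Fin (N + 1)) : Measurable (hotSupplyOf M N i : Rec N → ℝ) := by
  -- adapted from `ClampedTransferCoin.measurable_ite_fst_impulse`
  have h1 : MeasurableSet {c : Rec N | c.fst = i} :=
    HardSphereCollisionRecord.measurable_indices.fst (measurableSet_singleton i)
  have h2 : MeasurableSet {c : Rec N | M < |⟪c.preVel.2, c.impactVec⟫_ℝ|} :=
    measurableSet_lt measurable_const
      (HardSphereCollisionRecord.measurable_preVel.snd.inner HardSphereCollisionRecord.measurable_impactVec).abs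
  have h12 : MeasurableSet {c : Rec N | c.fst = i ∧ M < |⟪c.preVel.2, c.impactVec⟫_ℝ|} := by
    rw [Set.setOf_and]
    exact h1.inter h2
  have h3 : Measurable fun c : Rec N => max ((‖c.postVel.1‖ ^ 2 - ‖c.preVel.1‖ ^ 2) / 2) 0 :=
    (((HardSphereCollisionRecord.measurable_postVel.fst.norm.pow_const 2).sub
      (HardSphereCollisionRecord.measurable_preVel.fst.norm.pow_const 2)).div_const 2).max measurable_const
  unfold hotSupplyOf
  exact Measurable.ite h12 h3 measurable_const

/-- The hot supply does not read the time stamp of a record read off a configuration. -/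
theorem hotSupplyOf_ofConfig_time {σ : ℝ} (M : ℝ) (N : ℕ) (i : Fin (N + 1)) (w : Config (N + 1) (Fin 3) T3)
    (t t' : ℝ) (k l : Fin (N + 1)) :
    hotSupplyOf M N i (HardSphereCollisionRecord.ofConfig (Torus.geometry (Fin 3)) (hsDiameter σ N) w t k l) =
      hotSupplyOf M N i (HardSphereCollisionRecord.ofConfig (Torus.geometry (Fin 3)) (hsDiameter σ N) w t' k l) :=
  rfl

/-- **Stub (registered): the hot-supply window sum over `(a, b]`, extended by `0` off the good set, is measurable in the
datum** (`0 < σ < 1/2`) — `measurable_indicator_collisionSum_Ioc` with the measurable (`measurable_hotSupplyOf`),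
time-stamp-blind (`hotSupplyOf_ofConfig_time`) functional `hotSupplyOf M N i`. -/
theorem stub_hotSupplyMeasurable : HotSupplyMeasurable :=
  fun _ hσ hσ2 M N Φ i a b =>
    TransferActivityTailsTaggedSumMeasurable.measurable_indicator_collisionSum_Ioc hσ hσ2 Φ a b
      (measurable_hotSupplyOf M N i) (hotSupplyOf_ofConfig_time M N i)

end Summit.AtomisticToContinuum.HydrodynamicLimit.Theorems.EnergyActivityTailsHotSupplyMeasurable

end
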